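import Mathlib.NumberTheory.LSeries.Linearity
import Literature.NumberTheory.EllipticCurves.CuspFormLFunctionProofs
import Literature.NumberTheory.EllipticCurves.HeckeOperatorsDoubleCoset
import HarnessLib

/-!
# The Fricke involution on `Γ₀(N)`: Hecke's functional equation, commutation with `T_n`,
stability of the new subspace, and Atkin–Lehner's `w_N f = ± f` from multiplicity one (proofs for
`Literature.NumberTheory.EllipticCurves.CuspFormLFunction`)

D-0014 keeps `Literature/` sorry-free by stating cited results as named facts `def X : Prop`.
This sibling file of `Literature.NumberTheory.EllipticCurves.CuspFormLFunction` (trunk EllArithM,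
item C7) discharges three of its named facts (`frickeInvolution_apply_eq_slash`,
`frickeInvolution_frickeInvolution`, Hecke's `exists_completedCuspFormL_functional_equation`),
proves that `w_N` commutes with `T_n` for `(n, N) = 1` and preserves `S_k(Γ₀(N))^{new}`, and
thereby reduces the three Atkin–Lehner `w_N`-facts (`IsNewform0.exists_frickeInvolution_eq_smul`,
`IsNewform0.frickeInvolution_eq_smul`, `IsNewform0.frickeEigenvalue_eq_one_or_eq_neg_one`) and
`IsNewform0.exists_functional_equation` to the structure theory of newforms of `Newforms.lean`
(`span_newforms0`, `linearIndependent_newforms0`, `IsNewform0.eq_of_heckeEigenvalue_eq`):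

* `frickeInvolution_apply_eq_slash_holds` — **discharge** of `frickeInvolution_apply_eq_slash N k`:
  `w_N f = N^{1-k/2} • (f ∣[k] w_N)` as functions on `ℍ`. The Fricke matrix `w_N = (0 -1; N 0)`
  normalises `Γ₀(N)` (`frickeGL_mul_mul_inv_mem`: `w_N (a b; c d) w_N⁻¹ = (d, -c/N; -Nb, a)`), so
  the double coset `Γ₀(N) w_N Γ₀(N) = Γ₀(N) w_N` is a single right coset
  (`isDoubleCosetDecomp_frickeGL`) and the double coset formula
  (`coe_cuspHeckeCorrespondence_eq_sum` of `HeckeOperatorsDoubleCoset`) has the single term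
  `f ∣[k] w_N` (Atkin–Lehner 1970, §2; Diamond–Shurman §5.10, Ex. 1.5.4).
* `frickeInvolution_frickeInvolution_holds` — **discharge** of `frickeInvolution_frickeInvolution N k`:
  `w_N (w_N f) = (-1)^k f` (Atkin–Lehner 1970, Lemma 7; Diamond–Shurman Ex. 5.10.2 for
  `W_N = i^k w_N`), pointwise from `w_N • (w_N • τ) = τ` (`frickeGL_smul_frickeGL_smul`) and
  `N^{2-k} N^{2k-2} (-1/τ)^{-k} (Nτ)^{-k} = (-1)^k`.
* `exists_completedCuspFormL_functional_equation_holds` — **discharge of Hecke's functional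
  equation**, the named fact `exists_completedCuspFormL_functional_equation N k`, for every level
  `N ≥ 1` and every weight `k`. For `k ≥ -2`
  (`exists_completedCuspFormL_functional_equation_of_neg_two_le`): for `f ∈ S_k(Γ₀(N))`,
  `Λ(s) = N^{s/2} ∫₀^∞ f(it) t^{s-1} dt`
  and `Λ'(s) = N^{s/2} ∫₀^∞ (w_N f)(it) t^{s-1} dt` are entire continuations of the raw products
  `Λ_N(f, s)`, `Λ_N(w_N f, s)` (`cpow_mul_mellin_mem_completedCuspFormLContinuations`, from the
  Mellin machinery of `CuspFormLFunctionProofs`: `differentiable_mellin_imagAxis`,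
  `mellin_imagAxis_eq`), and `Λ(s) = i^k Λ'(k - s)` (Hecke 1936; Diamond–Shurman Thm. 5.10.2,
  PDF p. 230, stated there for `W_N`-eigenforms with `W_N = i^k w_N`: "`Λ_N(s) = ± Λ_N(k - s)`").
  Proof as printed: on the imaginary axis `f(i/(Nt)) = N^{k/2} (it)^k (w_N f)(it)`
  (`slash_frickeGL_imagAxis`, `imagAxis_mul_inv_eq_of_eq_smul_slash`), and the substitution
  `t ↦ 1/(Nt)` in the Mellin integral (Mathlib `mellin_comp_mul_left`, `mellin_comp_inv`,
  `mellin_cpow_smul`) gives `N^{-s} 𝓜f(-s) = N^{k/2} i^k 𝓜(w_N f)(s + k)`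
  (`cpow_mul_mellin_imagAxis_neg_eq`), which is the functional equation after multiplying by
  `N^{s/2}`. The restriction `k ≥ -2` is forced by the statement file's raw product
  `completedCuspFormL N f s = N^{s/2} (2π)^{-s} Γ(s) L(f, s)` with Mathlib's `Complex.Gamma`
  (junk value `0` at the poles): an entire `Λ` must agree with it on all of `re s > k/2 + 1`,
  which for `k ≤ -3` contains poles of `Γ`. For `k < 0` instead `S_k(Γ₀(N)) = 0` (Mathlib
  `ModularForm.isZero_of_neg_weight`; `coe_eq_zero_of_weight_neg`), the raw products vanish and
  `Λ = Λ' = 0` do the job.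
* `IsNewform0.exists_functional_equation_of` — **reduction** of the named fact
  `IsNewform0.exists_functional_equation` (`Λ_N(f, s) = i^k ε(f) Λ_N(f, k - s)` for a newform) to
  Hecke's functional equation and the Atkin–Lehner fact `IsNewform0.frickeInvolution_eq_smul`
  ("a newform is a `w_N`-eigenvector", Atkin–Lehner 1970, Thm. 3): if `w_N f = ε f` then the
  continuation of `Λ_N(w_N f, s) = Λ_N(ε f, s)` is `ε Λ` (`const_mul_mem_completedCuspFormLContinuations`,
  linearity of `q`-expansions and `L`-series, and uniqueness
  `subsingleton_completedCuspFormLContinuations`). Hence, Hecke's part being proved,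
  `IsNewform0.exists_functional_equation_of_frickeInvolution_eq_smul` (any weight) and
  `IsNewform0.exists_functional_equation_two_of_frickeInvolution_eq_smul` (weight `2`, all
  levels — the hypothesis consumed by `WeierstrassCurve.exists_hasFunctionalEquationSign_of_modularity`
  in `BSDRootNumberProofs` and by `RootNumberModularityProofs`): the functional equation of
  `L(E, s)` for a modular elliptic curve now rests on `exists_isNewformOf`
  (Breuil–Conrad–Diamond–Taylor 2001) and Atkin–Lehner's Thm. 3 only.
* `IsNewform0.frickeInvolution_eq_smul_of`, `IsNewform0.frickeEigenvalue_eq_one_or_eq_neg_one_of`: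
  the two other Atkin–Lehner-flavoured named facts of the statement file follow from
  `IsNewform0.exists_frickeInvolution_eq_smul` alone (defining property of `frickeEigenvalue`;
  a newform is nonzero, `IsNewform0.coe_ne_zero`), and
  `IsNewform0.exists_functional_equation_two_and_of_exists_frickeInvolution_eq_smul` packages the
  weight-`2` consequences consumed by the elliptic-curve files.
* `frickeInvolution_heckeT` — **`w_N` commutes with `T_n` for `gcd(n, N) = 1`** on `S_k(Γ₀(N))`
  (Atkin–Lehner 1970, Lemma 11; Diamond–Shurman Ex. 5.5.1(b) with Thm. 5.5.3), by double cosets: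
  `w_N⁻¹ diag(1, n) w_N = diag(n, 1)` (`frickeGL_inv_mul_diagGL_mul`) lies in
  `Γ₀(N) diag(1, n) Γ₀(N)` (`diagGL_swap_mem_doubleCoset`, from the row-and-column reduction
  `HeckeTComm.exists_gamma1_mul_mul_gamma0_eq_diagonal` of `HeckeOperatorsDoubleCoset`,
  Shimura Prop. 3.32), so conjugating a system of representatives of `Γ₀(N) \ Γ₀(N) diag(1,n) Γ₀(N)`
  by `w_N` gives another one (`IsDoubleCosetDecomp.conj`), and the double coset formula finishes.
* `frickeInvolution_mem_newSubspace0` — **`w_N` preserves `S_k(Γ₀(N))^{new}`** (the joint kernel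
  of the adjoint degeneracy maps `[Γ₀(N) diag(1,d) Γ₀(M)]`; Atkin–Lehner 1970, Lemma 26): for an
  index `(M, d)` with `M d d' = N`,
  `w_N diag(1,d) = (d·1) diag(1,d') w_M` (`frickeGL_mul_diagGL_one_eq`), so the adjoint map of
  `w_N f` is a sum over representatives of `Γ₀(N) \ Γ₀(N) (w_N diag(1,d)) Γ₀(M)` which can be
  taken either as `{w_N αᵢ}` (`IsDoubleCosetDecomp.normaliser_mul`) or as `{(d·1) βⱼ w_M}`
  (`IsDoubleCosetDecomp.centre_mul_mul_normaliser`), and the latter gives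
  `c d^{k-2} (adj_{d'} f) ∣ w_M = 0` for `f` new (`slash_diagGL_self`: the scalar matrix `d·1`
  acts by `d^{k-2}`).
* `IsNewform0.exists_frickeInvolution_eq_smul_of` — **Atkin–Lehner 1970, Thm. 3 (the `w_N`
  part): a newform is a `w_N`-eigenvector with eigenvalue `±1`**, from `span_newforms0`,
  `linearIndependent_newforms0` and strong multiplicity one `IsNewform0.eq_of_heckeEigenvalue_eq`
  (Atkin–Lehner Thms. 4–5; Diamond–Shurman Thms. 5.8.2–5.8.3): `w_N f` is new and has the
  `T_p`-eigenvalues of `f` for `p ∤ N`, so in its expansion along the newform basis only `f`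
  occurs (`eq_of_linearCombination_eigenvector`); `ε² = 1` by `w_N² = (-1)^k` and `k` even
  (`eq_zero_of_odd_weight_gamma0`). `IsNewform0.frickeFacts_of_multiplicityOne` bundles the four
  consequences. **Upshot for elliptic curves**: the functional equation of `L(E, s)` with sign
  `w(E)` (`WeierstrassCurve.hasFunctionalEquationSign_rootNumber`, via `BSDRootNumberProofs` /
  `RootNumberModularityProofs`) now rests on modularity (`exists_isNewformOf`, BCDT 2001) and the
  three structural newform facts only.

## References

* E. Hecke, *Über die Bestimmung Dirichletscher Reihen durch ihre Funktionalgleichung*,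
  Math. Ann. 112 (1936), 664–699.
* A. O. L. Atkin, J. Lehner, *Hecke operators on `Γ₀(m)`*, Math. Ann. 185 (1970), 134–160, §2,
  Lemma 7, Thm. 3.
* F. Diamond, J. Shurman, *A first course in modular forms*, GTM 228, Springer 2005 (lit store
  `book:diamond2005-first-course-modular-forms`), §5.10, Prop. 5.10.1, Thm. 5.10.2 (PDF p. 230),
  Ex. 1.5.4 (PDF p. 56).
* G. Shimura, *Introduction to the arithmetic theory of automorphic functions*, 1971, §3.4
  (double coset operators).
-/

noncomputable section

open scoped MatrixGroups ModularForm

open CongruenceSubgroup Matrix.SpecialLinearGroup UpperHalfPlane Complex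

namespace Literature.NumberTheory.EllipticCurves.ModularForms

section FrickeCoset

variable (N : ℕ) [NeZero N]

/-- The real matrix underlying `w_N = (0 -1; N 0)` viewed in `GL(2, ℝ)`. [folklore] -/
lemma val_glCast_frickeGL :
    ((glCast (frickeGL N : GL (Fin 2) ℚ) : GL (Fin 2) ℝ) : Matrix (Fin 2) (Fin 2) ℝ) =
      !![(0 : ℝ), -1; N, 0] := by
  ext i j
  fin_cases i <;> fin_cases j <;> simp [glCast, frickeGL]

/-- `w_N` normalises `Γ₀(N)`: for `γ = (a b; c d) ∈ Γ₀(N)`, `w_N γ w_N⁻¹ = (d, -c/N; -Nb, a) ∈ Γ₀(N)`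
(Atkin–Lehner 1970, §2; Diamond–Shurman §5.10). [folklore] -/
theorem frickeGL_mul_mul_inv_mem {x : GL (Fin 2) ℝ}
    (hx : x ∈ (Gamma0 N : Subgroup (GL (Fin 2) ℝ))) :
    glCast (frickeGL N : GL (Fin 2) ℚ) * x * (glCast (frickeGL N : GL (Fin 2) ℚ))⁻¹ ∈
      (Gamma0 N : Subgroup (GL (Fin 2) ℝ)) := by
  obtain ⟨γ, hγ, rfl⟩ := Subgroup.mem_map.mp hx
  have h10 : ((γ 1 0 : ℤ) : ZMod N) = 0 := Gamma0_mem.mp hγ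
  obtain ⟨c', hc'⟩ := (ZMod.intCast_zmod_eq_zero_iff_dvd _ N).mp h10
  have hdet : Matrix.det !![γ 1 1, -c'; -((N : ℤ) * γ 0 1), γ 0 0] = 1 := by
    have h := Matrix.SpecialLinearGroup.det_coe γ
    rw [Matrix.det_fin_two, hc'] at h
    rw [Matrix.det_fin_two_of]
    linear_combination h
  let δ : SL(2, ℤ) := ⟨!![γ 1 1, -c'; -((N : ℤ) * γ 0 1), γ 0 0], hdet⟩
  refine Subgroup.mem_map.mpr ⟨δ, Gamma0_mem.mpr (by simp [δ]), ?_⟩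
  rw [eq_mul_inv_iff_mul_eq]
  refine Units.ext ?_
  have hc'' : ((γ 1 0 : ℤ) : ℝ) = N * c' := by exact_mod_cast hc'
  rw [Matrix.GeneralLinearGroup.coe_mul, Matrix.GeneralLinearGroup.coe_mul, val_glCast_frickeGL,
    mapGL_coe_matrix, mapGL_coe_matrix]
  ext i j
  fin_cases i <;> fin_cases j <;>
    simp [δ, Matrix.mul_apply, Fin.sum_univ_two, hc''] <;> ring

/-- The double coset `Γ₀(N) w_N Γ₀(N)` is the single right coset `Γ₀(N) w_N` (because `w_N`
normalises `Γ₀(N)`), i.e. `w_N` alone is a system of representatives (Atkin–Lehner 1970, §2;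
Diamond–Shurman §5.10). [folklore] -/
theorem isDoubleCosetDecomp_frickeGL :
    IsDoubleCosetDecomp (Gamma0 N : Subgroup (GL (Fin 2) ℝ)) (Gamma0 N : Subgroup (GL (Fin 2) ℝ))
      (glCast (frickeGL N : GL (Fin 2) ℚ))
      (fun _ : Unit ↦ glCast (frickeGL N : GL (Fin 2) ℚ)) where
  mem _ := DoubleCoset.mem_doubleCoset.mpr ⟨1, one_mem _, 1, one_mem _, by simp⟩
  existsUnique x hx := by
    refine ⟨(), ?_, fun _ _ ↦ rfl⟩
    obtain ⟨γ, hγ, γ', hγ', rfl⟩ := DoubleCoset.mem_doubleCoset.mp hx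
    have : γ * glCast (frickeGL N : GL (Fin 2) ℚ) * γ' * (glCast (frickeGL N : GL (Fin 2) ℚ))⁻¹ =
        γ * (glCast (frickeGL N : GL (Fin 2) ℚ) * γ' * (glCast (frickeGL N : GL (Fin 2) ℚ))⁻¹) := by
      group
    rw [this]
    exact mul_mem hγ (frickeGL_mul_mul_inv_mem N hγ')

variable (k : ℤ)

/-- **Discharge of `frickeInvolution_apply_eq_slash`**: `w_N f = N^{1-k/2} • (f ∣[k] w_N)` as
functions on `ℍ`; the trace defining the double coset operator `[Γ₀(N) w_N Γ₀(N)]` has the single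
term `f ∣[k] w_N` (`isDoubleCosetDecomp_frickeGL` and the double coset formula
`coe_cuspHeckeCorrespondence_eq_sum`) (Atkin–Lehner 1970, §2; Diamond–Shurman §5.10).
[cite: AtkinLehner1970, §2] -/
theorem frickeInvolution_apply_eq_slash_holds : frickeInvolution_apply_eq_slash N k := by
  intro f
  have h := coe_cuspHeckeCorrespondence_eq_sum (Gamma0 N) (Gamma0 N) k
    (frickeGL N : GL (Fin 2) ℚ) (isDoubleCosetDecomp_frickeGL N) f
  rw [Fintype.sum_unique] at h
  unfold frickeInvolution
  rw [LinearMap.smul_apply, CuspForm.IsGLPos.coe_smul]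
  congr 1

/-- `det w_N = N`. [folklore] -/
lemma det_glCast_frickeGL : (glCast (frickeGL N : GL (Fin 2) ℚ)).det.val = N := by
  rw [Matrix.GeneralLinearGroup.val_det_apply, val_glCast_frickeGL, Matrix.det_fin_two_of]
  ring

/-- `w_N • τ = -1/(Nτ)` on `ℍ` (Diamond–Shurman §5.10). [folklore] -/
lemma coe_frickeGL_smul (τ : ℍ) :
    ((glCast (frickeGL N : GL (Fin 2) ℚ) • τ : ℍ) : ℂ) = -((N : ℂ) * τ)⁻¹ := by
  rw [coe_smul_of_det_pos (by rw [det_glCast_frickeGL]; exact_mod_cast NeZero.pos N), num, denom,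
    val_glCast_frickeGL]
  simp only [Matrix.of_apply, Matrix.cons_val', Matrix.cons_val_zero, Matrix.cons_val_one,
    Matrix.cons_val_fin_one]
  push_cast
  ring

/-- `w_N • (w_N • τ) = τ`: `w_N² = -N` acts trivially on `ℍ` (Atkin–Lehner 1970, Lemma 7).
[folklore] -/
lemma frickeGL_smul_frickeGL_smul (τ : ℍ) :
    glCast (frickeGL N : GL (Fin 2) ℚ) • (glCast (frickeGL N : GL (Fin 2) ℚ) • τ) = τ := by
  have hN : (N : ℂ) ≠ 0 := by exact_mod_cast NeZero.ne N
  have hτ : (τ : ℂ) ≠ 0 := τ.ne_zero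
  refine UpperHalfPlane.ext ?_
  rw [coe_frickeGL_smul, coe_frickeGL_smul]
  field_simp

/-- **Discharge of `frickeInvolution_frickeInvolution`**: `w_N (w_N f) = (-1)^k f`
(Atkin–Lehner 1970, Lemma 7; Diamond–Shurman Ex. 5.10.2 for `W_N = i^k w_N`). Pointwise,
`(w_N (w_N f))(τ) = c² N^{2(k-1)} (N τ')^{-k} (N τ)^{-k} f(τ)` with `c = N^{1-k/2}`,
`τ' = w_N τ = -1/(Nτ)`, and `c² N^{2k-2} (-1/τ)^{-k} (Nτ)^{-k} = (-1)^k`. [cite: AtkinLehner1970, Lemma 7] -/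
theorem frickeInvolution_frickeInvolution_holds : frickeInvolution_frickeInvolution N k := by
  intro f
  have hN0 : (N : ℂ) ≠ 0 := by exact_mod_cast NeZero.ne N
  have hNpos : (0 : ℝ) < N := by exact_mod_cast NeZero.pos N
  apply DFunLike.coe_injective
  have h := frickeInvolution_apply_eq_slash_holds N k
  rw [h (frickeInvolution N k f), h f, CuspForm.IsGLPos.coe_smul]
  set c : ℂ := (((N : ℝ) ^ (1 - (k : ℝ) / 2) : ℝ) : ℂ) with hc_def
  have hc : c = (N : ℂ) ^ (1 - (k : ℂ) / 2) := by
    rw [hc_def, Complex.ofReal_cpow (Nat.cast_nonneg N)]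
    push_cast
    ring_nf
  -- `c² = N^{2-k}` as an integer power
  have hcc : c * c = (N : ℂ) ^ (2 - k) := by
    rw [hc, ← cpow_add _ _ hN0, ← cpow_intCast]
    congr 1
    push_cast
    ring
  ext τ
  have hτ : (τ : ℂ) ≠ 0 := τ.ne_zero
  rw [Pi.smul_apply, ModularForm.slash_apply, σ_glCast, Pi.smul_apply, ModularForm.slash_apply,
    σ_glCast, frickeGL_smul_frickeGL_smul, det_glCast_frickeGL, denom, denom, val_glCast_frickeGL,
    coe_frickeGL_smul, Pi.smul_apply]
  simp only [Matrix.of_apply, Matrix.cons_val', Matrix.cons_val_zero, Matrix.cons_val_one,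
    Matrix.cons_val_fin_one, Nat.abs_cast, smul_eq_mul]
  push_cast
  simp only [add_zero]
  rw [show (N : ℂ) * -((N : ℂ) * τ)⁻¹ = -(τ : ℂ)⁻¹ by field_simp]
  -- the scalar identity `c² N^{2k-2} (-1/τ)^{-k} (Nτ)^{-k} = (-1)^k`
  have hNk : (N : ℂ) ^ k ≠ 0 := zpow_ne_zero k hN0
  have hτk : (τ : ℂ) ^ k ≠ 0 := zpow_ne_zero k hτ
  have key : c * c * ((N : ℂ) ^ (k - 1) * (N : ℂ) ^ (k - 1) * ((N : ℂ) * τ) ^ (-k)) *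
      (-(τ : ℂ)⁻¹) ^ (-k) = (-1) ^ k := by
    rw [hcc, zpow_neg (-(τ : ℂ)⁻¹), ← inv_zpow, inv_neg, inv_inv, neg_eq_neg_one_mul (τ : ℂ),
      mul_zpow, mul_zpow, zpow_neg, zpow_neg, zpow_sub₀ hN0, zpow_sub₀ hN0]
    field_simp
  linear_combination (f τ) * key

end FrickeCoset

/-! ### The Fricke involution on the imaginary axis -/

section ImagAxis

-- `𝕀[f] t = f(it)`: restriction of `f : ℍ → ℂ` to the imaginary axis (local notation, as in
-- `CuspFormLFunctionProofs`).
local notation "𝕀[" f "]" => fun t : ℝ ↦ (f : ℍ → ℂ) (UpperHalfPlane.ofComplex (Complex.I * (t : ℂ)))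

variable (N : ℕ) [NeZero N]

/-- `w_N` maps `it` to `i/(Nt)`: `w_N • (it) = -1/(N i t) = i (N t)⁻¹` for `t > 0`. [folklore] -/
lemma coe_frickeGL_smul_I_mul {t : ℝ} (ht : 0 < t) :
    ((glCast (frickeGL N : GL (Fin 2) ℚ) • (⟨Complex.I * t, by simpa using ht⟩ : ℍ) : ℍ) : ℂ) =
      Complex.I * ((N * t)⁻¹ : ℝ) := by
  have hN : (N : ℂ) ≠ 0 := by exact_mod_cast NeZero.ne N
  have ht' : (t : ℂ) ≠ 0 := by exact_mod_cast ht.ne'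
  rw [coe_smul_of_det_pos (by rw [det_glCast_frickeGL]; exact_mod_cast NeZero.pos N), num, denom,
    val_glCast_frickeGL]
  simp only [Matrix.of_apply, Matrix.cons_val', Matrix.cons_val_zero, Matrix.cons_val_one,
    Matrix.cons_val_fin_one]
  push_cast
  have hI : Complex.I ≠ 0 := Complex.I_ne_zero
  field_simp
  ring_nf
  rw [Complex.I_sq]
  ring

/-- **`f ∣[k] w_N` on the imaginary axis**: for `t > 0`,
`(f ∣[k] w_N)(it) = N^{k-1} (N i t)^{-k} f(i/(Nt))` (Mathlib's slash action carries the factor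
`|det|^{k-1} = N^{k-1}`; Diamond–Shurman §5.10, proof of Thm. 5.10.2). [folklore] -/
lemma slash_frickeGL_imagAxis (f : ℍ → ℂ) (k : ℤ) {t : ℝ} (ht : 0 < t) :
    𝕀[f ∣[k] glCast (frickeGL N : GL (Fin 2) ℚ)] t =
      (N : ℂ) ^ (k - 1) * ((N : ℂ) * (Complex.I * t)) ^ (-k) * 𝕀[f] (N * t)⁻¹ := by
  have hNt : 0 < (N : ℝ) * t := mul_pos (by exact_mod_cast NeZero.pos N) ht
  rw [imagAxis_apply_of_pos _ ht, imagAxis_apply_of_pos _ (inv_pos.mpr hNt),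
    ModularForm.slash_apply, σ_glCast, det_glCast_frickeGL, denom, val_glCast_frickeGL]
  have hpt : (glCast (frickeGL N : GL (Fin 2) ℚ) • (⟨Complex.I * t, by simpa using ht⟩ : ℍ) : ℍ) =
      ⟨Complex.I * ((N * t)⁻¹ : ℝ), by simpa using inv_pos.mpr hNt⟩ :=
    UpperHalfPlane.ext (coe_frickeGL_smul_I_mul N ht)
  rw [hpt]
  simp only [Matrix.of_apply, Matrix.cons_val', Matrix.cons_val_zero, Matrix.cons_val_one,
    Matrix.cons_val_fin_one, Nat.abs_cast]
  push_cast
  ring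

/-- **`w_N f` on the imaginary axis, inverted.** If `g = N^{1-k/2} • (f ∣[k] w_N)` as functions on
`ℍ` (the shape of `frickeInvolution_apply_eq_slash`), then for `t > 0`
`f(i/(Nt)) = N^{k/2} (it)^k g(it)`, here written `f(i (Nt)⁻¹) = C · t^k · g(it)` with the constant
`C = (N^{1-k/2})⁻¹ N i^k` (Diamond–Shurman §5.10, proof of Thm. 5.10.2). [folklore] -/
lemma imagAxis_mul_inv_eq_of_eq_smul_slash (f g : ℍ → ℂ) (k : ℤ)
    (hg : g = (((N : ℝ) ^ (1 - (k : ℝ) / 2) : ℝ) : ℂ) • (f ∣[k] glCast (frickeGL N : GL (Fin 2) ℚ)))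
    {t : ℝ} (ht : 0 < t) :
    𝕀[f] ((N : ℝ) * t)⁻¹ =
      ((((N : ℝ) ^ (1 - (k : ℝ) / 2) : ℝ) : ℂ)⁻¹ * N * Complex.I ^ k) * (t : ℂ) ^ (k : ℂ) *
        𝕀[g] t := by
  have hN0 : (N : ℂ) ≠ 0 := by exact_mod_cast NeZero.ne N
  have hNpos : (0 : ℝ) < N := by exact_mod_cast NeZero.pos N
  set c : ℂ := (((N : ℝ) ^ (1 - (k : ℝ) / 2) : ℝ) : ℂ) with hc_def
  have hc : c ≠ 0 := by
    rw [hc_def]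
    exact_mod_cast (Real.rpow_pos_of_pos hNpos _).ne'
  have ht0 : (t : ℂ) ≠ 0 := by exact_mod_cast ht.ne'
  have hI : Complex.I ≠ 0 := Complex.I_ne_zero
  have h1 : 𝕀[g] t =
      c * ((N : ℂ) ^ (k - 1) * ((N : ℂ) * (Complex.I * t)) ^ (-k) * 𝕀[f] ((N : ℝ) * t)⁻¹) := by
    rw [← slash_frickeGL_imagAxis N f k ht]
    simp only [hg, Pi.smul_apply, smul_eq_mul]
  rw [h1, cpow_intCast, zpow_neg, mul_zpow, mul_zpow, zpow_sub₀ hN0, zpow_one]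
  field_simp

end ImagAxis

/-! ### Hecke's functional equation -/

section FunctionalEquation

-- `𝕀[f] t = f(it)` (local notation, as above).
local notation "𝕀[" f "]" => fun t : ℝ ↦ (f : ℍ → ℂ) (UpperHalfPlane.ofComplex (Complex.I * (t : ℂ)))

variable {N : ℕ} [NeZero N]

open MeasureTheory Set in
/-- Mellin transforms of functions agreeing on `(0, ∞)` agree. [folklore] -/
lemma mellin_congr_Ioi {F G : ℝ → ℂ} (h : EqOn F G (Ioi 0)) (s : ℂ) : mellin F s = mellin G s :=
  setIntegral_congr_fun measurableSet_Ioi fun t ht ↦ by simp only [h ht]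

/-- **Hecke's candidate `Λ(s) = N^{s/2} ∫₀^∞ f(it) t^{s-1} dt` is an entire continuation of
`Λ_N(f, s)`** for `f ∈ S_k(Γ₀(N))`, `k ≥ -2`: it is entire (`differentiable_mellin_imagAxis`) and
equals `N^{s/2} (2π)^{-s} Γ(s) L(f, s)` for `re s > k/2 + 1` (`mellin_imagAxis_eq`; the restriction
`k ≥ -2` makes this half-plane avoid the poles of `Γ`, where Mathlib's `Complex.Gamma` and hence
the raw product `completedCuspFormL` take the junk value `0`) (Hecke 1936; Diamond–Shurman
Thm. 5.10.2). [cite: DiamondShurman2005, Thm. 5.10.2] -/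
theorem cpow_mul_mellin_mem_completedCuspFormLContinuations {k : ℤ} (hk : -2 ≤ k)
    (f : CuspForm (Gamma0 N) k) :
    (fun s ↦ (N : ℂ) ^ (s / 2) * mellin 𝕀[f] s) ∈ completedCuspFormLContinuations N f := by
  have hN : (N : ℂ) ≠ 0 := by exact_mod_cast NeZero.ne N
  refine ⟨fun s ↦ ?_, fun s hs ↦ ?_⟩
  · exact ((differentiableAt_id.div_const 2).const_cpow (Or.inl hN)).mul
      (differentiable_mellin_imagAxis f s)
  · have hk' : (-2 : ℝ) ≤ k := by exact_mod_cast hk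
    have hs₀ : 0 < s.re := by linarith
    dsimp only
    rw [mellin_imagAxis_eq (strictWidthInfty_Gamma0 N) f hs hs₀, completedCuspFormL]
    ring

/-- **The Mellin transforms of `f` and `w_N f` along the imaginary axis**: if
`g = N^{1-k/2} • (f ∣[k] w_N)` on `ℍ`, then for every `s`,
`N^{-s} 𝓜(f(i·))(-s) = C · 𝓜(g(i·))(s + k)` with `C = (N^{1-k/2})⁻¹ N i^k`
(substitute `t ↦ 1/(Nt)` in the Mellin integral: Mathlib `mellin_comp_mul_left`,
`mellin_comp_inv`, `mellin_cpow_smul`; Diamond–Shurman §5.10, proof of Thm. 5.10.2).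
[cite: DiamondShurman2005, Thm. 5.10.2] -/
theorem cpow_mul_mellin_imagAxis_neg_eq (f g : ℍ → ℂ) (k : ℤ)
    (hg : g = (((N : ℝ) ^ (1 - (k : ℝ) / 2) : ℝ) : ℂ) • (f ∣[k] glCast (frickeGL N : GL (Fin 2) ℚ)))
    (s : ℂ) :
    (N : ℂ) ^ (-s) * mellin 𝕀[f] (-s) =
      ((((N : ℝ) ^ (1 - (k : ℝ) / 2) : ℝ) : ℂ)⁻¹ * N * Complex.I ^ k) * mellin 𝕀[g] (s + k) := by
  have hNpos : (0 : ℝ) < N := by exact_mod_cast NeZero.pos N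
  set C : ℂ := (((N : ℝ) ^ (1 - (k : ℝ) / 2) : ℝ) : ℂ)⁻¹ * N * Complex.I ^ k with hC
  have hlhs : mellin (fun t : ℝ ↦ 𝕀[f] ((N : ℝ) * t)⁻¹) s = (N : ℂ) ^ (-s) * mellin 𝕀[f] (-s) := by
    have h := mellin_comp_mul_left (fun u : ℝ ↦ 𝕀[f] u⁻¹) s hNpos
    have h' := mellin_comp_inv 𝕀[f] s
    beta_reduce at h h' ⊢
    rw [h', Complex.ofReal_natCast, smul_eq_mul] at h
    exact h
  have hrhs : mellin (fun t : ℝ ↦ C * (t : ℂ) ^ (k : ℂ) * 𝕀[g] t) s = C * mellin 𝕀[g] (s + k) := by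
    have h := mellin_const_smul (fun t : ℝ ↦ (t : ℂ) ^ (k : ℂ) • 𝕀[g] t) s C
    have h' := mellin_cpow_smul 𝕀[g] s k
    beta_reduce at h h' ⊢
    rw [h'] at h
    simp only [smul_eq_mul] at h
    rw [← h]
    congr 1
    ext t
    ring
  rw [← hlhs, ← hrhs]
  exact mellin_congr_Ioi (fun t ht ↦ imagAxis_mul_inv_eq_of_eq_smul_slash N f g k hg ht) s

variable (N) in
/-- **Hecke's functional equation** for `f ∈ S_k(Γ₀(N))`, `k ≥ -2` — the named fact
`exists_completedCuspFormL_functional_equation N k` of `CuspFormLFunction.lean` (Hecke 1936;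
Diamond–Shurman Thm. 5.10.2): `Λ(s) = N^{s/2} ∫₀^∞ f(it) t^{s-1} dt` and
`Λ'(s) = N^{s/2} ∫₀^∞ (w_N f)(it) t^{s-1} dt` are entire continuations of `Λ_N(f, s)` and
`Λ_N(w_N f, s)`, and `Λ(s) = i^k Λ'(k - s)`, from `f(i/(Nt)) = N^{k/2} (it)^k (w_N f)(it)`
(`frickeInvolution_apply_eq_slash_holds`) by the substitution `t ↦ 1/(Nt)`. (For `k ≤ -3` the
space `S_k(Γ₀(N))` is zero, which Mathlib does not know; the Mellin argument needs `k ≥ -2`, see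
`cpow_mul_mellin_mem_completedCuspFormLContinuations`.) [cite: DiamondShurman2005, Thm. 5.10.2] -/
theorem exists_completedCuspFormL_functional_equation_of_neg_two_le (k : ℤ) (hk : -2 ≤ k) :
    exists_completedCuspFormL_functional_equation N k := by
  intro f
  have hN0 : (N : ℂ) ≠ 0 := by exact_mod_cast NeZero.ne N
  have hNpos : (0 : ℝ) < N := by exact_mod_cast NeZero.pos N
  set g := frickeInvolution N k f with hg_def
  have hg : (⇑g : ℍ → ℂ) =
      (((N : ℝ) ^ (1 - (k : ℝ) / 2) : ℝ) : ℂ) • (⇑f ∣[k] glCast (frickeGL N : GL (Fin 2) ℚ)) :=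
    frickeInvolution_apply_eq_slash_holds N k f
  refine ⟨_, cpow_mul_mellin_mem_completedCuspFormLContinuations hk f,
    _, cpow_mul_mellin_mem_completedCuspFormLContinuations hk g, fun s ↦ ?_⟩
  have key := cpow_mul_mellin_imagAxis_neg_eq f g k hg (-s)
  rw [neg_neg, neg_add_eq_sub] at key
  -- `𝓜(f(i·))(s) = N^{-s} C 𝓜(g(i·))(k - s)`
  have hNs : (N : ℂ) ^ s ≠ 0 := by
    rw [Ne, cpow_eq_zero_iff, not_and_or]
    exact Or.inl hN0
  have hM : mellin 𝕀[f] s = (N : ℂ) ^ (-s) *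
      (((((N : ℝ) ^ (1 - (k : ℝ) / 2) : ℝ) : ℂ)⁻¹ * N * Complex.I ^ k) * mellin 𝕀[g] (k - s)) := by
    rw [← key, cpow_neg, inv_mul_cancel_left₀ hNs]
  have hc : (((N : ℝ) ^ (1 - (k : ℝ) / 2) : ℝ) : ℂ) = (N : ℂ) ^ (1 - (k : ℂ) / 2) := by
    rw [Complex.ofReal_cpow (Nat.cast_nonneg N)]
    push_cast
    ring_nf
  have hexp : (N : ℂ) ^ (s / 2) * (N : ℂ) ^ (-s) * (((N : ℂ) ^ (1 - (k : ℂ) / 2))⁻¹ * N) =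
      (N : ℂ) ^ (((k : ℂ) - s) / 2) := by
    calc (N : ℂ) ^ (s / 2) * (N : ℂ) ^ (-s) * (((N : ℂ) ^ (1 - (k : ℂ) / 2))⁻¹ * N)
        = (N : ℂ) ^ (s / 2) * (N : ℂ) ^ (-s) *
            ((N : ℂ) ^ (-(1 - (k : ℂ) / 2)) * (N : ℂ) ^ (1 : ℂ)) := by
          rw [cpow_neg (N : ℂ) (1 - (k : ℂ) / 2), cpow_one]
      _ = (N : ℂ) ^ (s / 2 + -s + (-(1 - (k : ℂ) / 2) + 1)) := by
          rw [cpow_add _ _ hN0, cpow_add _ _ hN0, cpow_add _ _ hN0]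
      _ = (N : ℂ) ^ (((k : ℂ) - s) / 2) := by
          congr 1
          ring
  rw [hM, hc]
  linear_combination (Complex.I ^ k * mellin 𝕀[g] (k - s)) * hexp

/-- **Negative weight.** A cusp form of weight `k < 0` on an arithmetic subgroup vanishes
(Mathlib `ModularForm.isZero_of_neg_weight`, via the norm down to level one). [folklore] -/
lemma coe_eq_zero_of_weight_neg {Γ : Subgroup (GL (Fin 2) ℝ)} [Γ.IsArithmetic] {k : ℤ}
    (hk : k < 0) (f : CuspForm Γ k) : (⇑f : ℍ → ℂ) = 0 := by
  have h := ModularForm.isZero_of_neg_weight hk (f : ModularForm Γ k)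
  rw [← ModularForm.coe_eq_zero_iff] at h
  exact h

/-- In negative weight the raw product `Λ_N(f, s)` vanishes identically (`f = 0`). [folklore] -/
lemma completedCuspFormL_eq_zero_of_weight_neg {k : ℤ} (hk : k < 0) (f : CuspForm (Gamma0 N) k)
    (s : ℂ) : completedCuspFormL N f s = 0 := by
  have hf : (⇑f : ℍ → ℂ) = 0 := coe_eq_zero_of_weight_neg hk f
  have hc : cuspCoeff f = 0 := by
    ext n
    unfold cuspCoeff
    rw [hf, UpperHalfPlane.qExpansion_zero]
    simp
  unfold completedCuspFormL cuspFormLSeries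
  rw [hc, LSeries_zero, Pi.zero_apply, mul_zero]

variable (N) in
/-- **Hecke's functional equation on `Γ₀(N)`, all weights** — discharge of the named fact
`exists_completedCuspFormL_functional_equation N k` (Hecke 1936; Diamond–Shurman Thm. 5.10.2):
for `k ≥ -2` by the Mellin-transform argument
(`exists_completedCuspFormL_functional_equation_of_neg_two_le`), and for `k < 0` because
`S_k(Γ₀(N)) = 0` (`coe_eq_zero_of_weight_neg`), so that `Λ = Λ' = 0` are entire continuations of
the (vanishing) raw products and the functional equation is `0 = 0`.
[cite: DiamondShurman2005, Thm. 5.10.2] [cite: Hecke1936] -/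
theorem exists_completedCuspFormL_functional_equation_holds (k : ℤ) :
    exists_completedCuspFormL_functional_equation N k := by
  rcases lt_or_ge k 0 with hk | hk
  · intro f
    refine ⟨0, ⟨differentiable_const 0, fun s _ ↦ ?_⟩, 0, ⟨differentiable_const 0, fun s _ ↦ ?_⟩,
      fun s ↦ by simp⟩
    · rw [Pi.zero_apply, completedCuspFormL_eq_zero_of_weight_neg hk]
    · rw [Pi.zero_apply, completedCuspFormL_eq_zero_of_weight_neg hk]
  · exact exists_completedCuspFormL_functional_equation_of_neg_two_le N k (by omega)

/-! ### Linearity of the continuation sets; the functional equation of a newform -/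

omit [NeZero N] in
/-- `aₙ(ε • f) = ε · aₙ(f)` (`q`-expansions are linear; Mathlib `ModularForm.qExpansion_smul`).
[folklore] -/
lemma cuspCoeff_smul {k : ℤ} (ε : ℂ) (f : CuspForm (Gamma0 N) k) (n : ℕ) :
    cuspCoeff (ε • f) n = ε * cuspCoeff f n := by
  have h1 : (1 : ℝ) ∈ (Gamma0 N : Subgroup (GL (Fin 2) ℝ)).strictPeriods :=
    strictWidthInfty_Gamma0 N ▸
      (Gamma0 N : Subgroup (GL (Fin 2) ℝ)).strictWidthInfty_mem_strictPeriods
  unfold cuspCoeff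
  rw [CuspForm.IsGLPos.coe_smul, ModularForm.qExpansion_smul one_pos h1 ε f]
  simp

omit [NeZero N] in
/-- `L(ε • f, s) = ε · L(f, s)` (Mathlib `LSeries_smul`). [folklore] -/
lemma cuspFormLSeries_smul {k : ℤ} (ε : ℂ) (f : CuspForm (Gamma0 N) k) (s : ℂ) :
    cuspFormLSeries (ε • f) s = ε * cuspFormLSeries f s := by
  unfold cuspFormLSeries
  rw [← LSeries_smul]
  congr 1
  ext n
  rw [cuspCoeff_smul, Pi.smul_apply, smul_eq_mul]

omit [NeZero N] in
/-- `Λ_N(ε • f, s) = ε · Λ_N(f, s)` for the raw products. [folklore] -/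
lemma completedCuspFormL_smul {k : ℤ} (ε : ℂ) (f : CuspForm (Gamma0 N) k) (s : ℂ) :
    completedCuspFormL N (ε • f) s = ε * completedCuspFormL N f s := by
  unfold completedCuspFormL
  rw [cuspFormLSeries_smul]
  ring

omit [NeZero N] in
/-- If `Λ` is an entire continuation of `Λ_N(f, s)` then `ε Λ` is one of `Λ_N(ε • f, s)`. [folklore] -/
lemma const_mul_mem_completedCuspFormLContinuations {k : ℤ} {f : CuspForm (Gamma0 N) k} {Λ : ℂ → ℂ}
    (hΛ : Λ ∈ completedCuspFormLContinuations N f) (ε : ℂ) :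
    (fun s ↦ ε * Λ s) ∈ completedCuspFormLContinuations N (ε • f) := by
  refine ⟨(differentiable_const ε).mul hΛ.1, fun s hs ↦ ?_⟩
  dsimp only
  rw [hΛ.2 s hs, completedCuspFormL_smul]

/-- **Functional equation of a `w_N`-eigenform** (Hecke 1936; Diamond–Shurman Thm. 5.10.2 as
printed: "if `f` is an eigenform of `W_N` with eigenvalue `±1` then `Λ_N(s) = ± i^k… Λ_N(k - s)`"):
if `w_N f = ε • f` and Hecke's functional equation holds in weight `k` on `Γ₀(N)`
(`exists_completedCuspFormL_functional_equation N k`), then the entire continuation `Λ` of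
`Λ_N(f, s)` satisfies `Λ(s) = i^k ε Λ(k - s)`: the continuation of `Λ_N(w_N f, s) = Λ_N(ε f, s)` is
`ε Λ` by uniqueness (`subsingleton_completedCuspFormLContinuations`).
[cite: DiamondShurman2005, Thm. 5.10.2] -/
theorem exists_functional_equation_of_frickeInvolution_eq_smul {k : ℤ}
    (hFE : exists_completedCuspFormL_functional_equation N k) {f : CuspForm (Gamma0 N) k} {ε : ℂ}
    (hf : frickeInvolution N k f = ε • f) :
    ∃ Λ ∈ completedCuspFormLContinuations N f, ∀ s : ℂ, Λ s = Complex.I ^ k * ε * Λ (k - s) := by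
  obtain ⟨Λ, hΛ, Λ', hΛ', hfe⟩ := hFE f
  rw [hf] at hΛ'
  have hΛ'eq : Λ' = fun s ↦ ε * Λ s :=
    subsingleton_completedCuspFormLContinuations N (ε • f) hΛ'
      (const_mul_mem_completedCuspFormLContinuations hΛ ε)
  refine ⟨Λ, hΛ, fun s ↦ ?_⟩
  rw [hfe s, hΛ'eq, mul_assoc]

/-- **The functional equation of a newform from Hecke + Atkin–Lehner** — a reduction of the named
fact `IsNewform0.exists_functional_equation` (`Λ_N(f, s) = i^k ε(f) Λ_N(f, k - s)`) to the two
named facts it is made of: Hecke's functional equation for all of `S_k(Γ₀(N))`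
(`exists_completedCuspFormL_functional_equation N k`; Hecke 1936, Diamond–Shurman Thm. 5.10.2 —
*proved* for `k ≥ -2` in `exists_completedCuspFormL_functional_equation_of_neg_two_le`) and
"a newform is a `w_N`-eigenvector", `IsNewform0.frickeInvolution_eq_smul` (Atkin–Lehner 1970,
Thm. 3; multiplicity one). [cite: DiamondShurman2005, Thm. 5.10.2] [cite: AtkinLehner1970, Thm. 3] -/
theorem IsNewform0.exists_functional_equation_of {k : ℤ}
    (hFE : exists_completedCuspFormL_functional_equation N k)
    (hAL : IsNewform0.frickeInvolution_eq_smul (N := N) (k := k)) :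
    IsNewform0.exists_functional_equation (N := N) (k := k) :=
  fun hf ↦ exists_functional_equation_of_frickeInvolution_eq_smul hFE (hAL hf)

/-- **The functional equation of a newform from Atkin–Lehner alone**: with Hecke's functional
equation proved (`exists_completedCuspFormL_functional_equation_holds`), the named fact
`IsNewform0.exists_functional_equation` (any level, any weight; in weight `2` the case used for
elliptic curves) reduces to `IsNewform0.frickeInvolution_eq_smul` (Atkin–Lehner 1970, Thm. 3).
[cite: AtkinLehner1970, Thm. 3] [cite: DiamondShurman2005, Thm. 5.10.2] -/
theorem IsNewform0.exists_functional_equation_of_frickeInvolution_eq_smul {k : ℤ}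
    (hAL : IsNewform0.frickeInvolution_eq_smul (N := N) (k := k)) :
    IsNewform0.exists_functional_equation (N := N) (k := k) :=
  IsNewform0.exists_functional_equation_of
    (exists_completedCuspFormL_functional_equation_holds N k) hAL

/-- Weight `2`, all levels: the hypothesis
`∀ N, IsNewform0.exists_functional_equation (N := N) (k := 2)` of the elliptic-curve files
(`WeierstrassCurve.exists_hasFunctionalEquationSign_of_modularity` and its corollaries in
`BSDRootNumberProofs`; `RootNumberModularityProofs`) from
`∀ N, IsNewform0.frickeInvolution_eq_smul (N := N) (k := 2)` (Atkin–Lehner 1970, Thm. 3).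
[cite: AtkinLehner1970, Thm. 3] -/
theorem IsNewform0.exists_functional_equation_two_of_frickeInvolution_eq_smul
    (hAL : ∀ (N : ℕ) [NeZero N], IsNewform0.frickeInvolution_eq_smul (N := N) (k := 2))
    (N : ℕ) [NeZero N] : IsNewform0.exists_functional_equation (N := N) (k := 2) :=
  IsNewform0.exists_functional_equation_of_frickeInvolution_eq_smul (hAL N)

/-! ### The three Atkin–Lehner-flavoured facts reduce to one -/

/-- A newform is not the zero function (`a₁(f) = 1`). [folklore] -/
theorem IsNewform0.coe_ne_zero {k : ℤ} {f : CuspForm (Gamma0 N) k} (hf : IsNewform0 f) :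
    (⇑f : ℍ → ℂ) ≠ 0 := by
  intro h0
  have h1 : cuspCoeff f 1 = 1 := (isNormalized_iff_cuspCoeff_one f).mp hf.2.2
  unfold cuspCoeff at h1
  rw [h0, UpperHalfPlane.qExpansion_zero] at h1
  simp at h1

/-- Reduction of the named fact `IsNewform0.frickeInvolution_eq_smul` (`w_N f = ε(f) • f`) to
`IsNewform0.exists_frickeInvolution_eq_smul` (a newform is a `w_N`-eigenvector;
Atkin–Lehner 1970, Thm. 3), by the defining property of `frickeEigenvalue`.
[cite: AtkinLehner1970, Thm. 3] -/
theorem IsNewform0.frickeInvolution_eq_smul_of {k : ℤ}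
    (h : IsNewform0.exists_frickeInvolution_eq_smul (N := N) (k := k)) :
    IsNewform0.frickeInvolution_eq_smul (N := N) (k := k) := by
  intro f hf
  obtain ⟨ε, -, hε⟩ := h hf
  exact frickeInvolution_eq_frickeEigenvalue_smul ⟨ε, hε⟩

/-- Reduction of the named fact `IsNewform0.frickeEigenvalue_eq_one_or_eq_neg_one` (`ε(f) = ±1`)
to `IsNewform0.exists_frickeInvolution_eq_smul` (Atkin–Lehner 1970, Thm. 3): if `w_N f = ε f`
with `ε = ±1` then `(ε(f) - ε) • f = 0` and `f ≠ 0`. [cite: AtkinLehner1970, Thm. 3] -/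
theorem IsNewform0.frickeEigenvalue_eq_one_or_eq_neg_one_of {k : ℤ}
    (h : IsNewform0.exists_frickeInvolution_eq_smul (N := N) (k := k)) :
    IsNewform0.frickeEigenvalue_eq_one_or_eq_neg_one (N := N) (k := k) := by
  intro f hf
  obtain ⟨ε, hε1, hε⟩ := h hf
  have hfe := frickeInvolution_eq_frickeEigenvalue_smul ⟨ε, hε⟩
  rw [hfe] at hε
  have hsub : (frickeEigenvalue f - ε) • f = 0 := by rw [sub_smul, hε, sub_self]
  have hf0 : f ≠ 0 := fun h0 ↦ hf.coe_ne_zero (by rw [h0]; rfl)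
  have heq : frickeEigenvalue f = ε :=
    sub_eq_zero.mp ((smul_eq_zero.mp hsub).resolve_right hf0)
  rw [heq]
  exact hε1

/-- **All the Hecke/Atkin–Lehner inputs of the elliptic-curve files from one fact.** From
`IsNewform0.exists_frickeInvolution_eq_smul` in weight `2` at all levels (Atkin–Lehner 1970,
Thm. 3) follow, at all levels: Hecke's functional equation for newforms
(`IsNewform0.exists_functional_equation`, with Hecke's part proved here) and `ε(f) = ±1`
(`IsNewform0.frickeEigenvalue_eq_one_or_eq_neg_one`) — the two modular-forms hypotheses besides
modularity of `WeierstrassCurve.hasFunctionalEquationSign_rootNumber_of_modularity`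
(`RootNumberModularityProofs`). [cite: AtkinLehner1970, Thm. 3] -/
theorem IsNewform0.exists_functional_equation_two_and_of_exists_frickeInvolution_eq_smul
    (hAL : ∀ (N : ℕ) [NeZero N], IsNewform0.exists_frickeInvolution_eq_smul (N := N) (k := 2)) :
    (∀ (N : ℕ) [NeZero N], IsNewform0.exists_functional_equation (N := N) (k := 2)) ∧
      ∀ (N : ℕ) [NeZero N], IsNewform0.frickeEigenvalue_eq_one_or_eq_neg_one (N := N) (k := 2) :=
  ⟨fun N _ ↦ IsNewform0.exists_functional_equation_of_frickeInvolution_eq_smul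
      (IsNewform0.frickeInvolution_eq_smul_of (hAL N)),
    fun N _ ↦ IsNewform0.frickeEigenvalue_eq_one_or_eq_neg_one_of (hAL N)⟩

end FunctionalEquation

/-! ### `w_N` commutes with `T_n` for `n` coprime to `N` -/

section FrickeHecke

variable (N : ℕ) [NeZero N]

/-- `w_N² = -N` is a scalar matrix, hence central: `w_N⁻¹ x w_N = w_N x w_N⁻¹` for all
`x ∈ GL(2, ℝ)` (Atkin–Lehner 1970, Lemma 7). [folklore] -/
lemma frickeGL_inv_mul_mul_eq (x : GL (Fin 2) ℝ) :
    (glCast (frickeGL N : GL (Fin 2) ℚ))⁻¹ * x * glCast (frickeGL N : GL (Fin 2) ℚ) =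
      glCast (frickeGL N : GL (Fin 2) ℚ) * x * (glCast (frickeGL N : GL (Fin 2) ℚ))⁻¹ := by
  set w := glCast (frickeGL N : GL (Fin 2) ℚ) with hw
  have hz : w * w * x = x * (w * w) := by
    refine Units.ext ?_
    rw [Matrix.GeneralLinearGroup.coe_mul, Matrix.GeneralLinearGroup.coe_mul,
      Matrix.GeneralLinearGroup.coe_mul, Matrix.GeneralLinearGroup.coe_mul, hw, val_glCast_frickeGL]
    ext i j
    fin_cases i <;> fin_cases j <;> simp [Matrix.mul_apply, Fin.sum_univ_two] <;> ring
  calc w⁻¹ * x * w = w⁻¹ * (x * (w * w)) * w⁻¹ := by group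
    _ = w⁻¹ * (w * w * x) * w⁻¹ := by rw [hz]
    _ = w * x * w⁻¹ := by group

/-- Conjugation by `w_N⁻¹` also preserves `Γ₀(N)`. [folklore] -/
lemma frickeGL_inv_mul_mul_mem {x : GL (Fin 2) ℝ}
    (hx : x ∈ (Gamma0 N : Subgroup (GL (Fin 2) ℝ))) :
    (glCast (frickeGL N : GL (Fin 2) ℚ))⁻¹ * x * glCast (frickeGL N : GL (Fin 2) ℚ) ∈
      (Gamma0 N : Subgroup (GL (Fin 2) ℝ)) := by
  rw [frickeGL_inv_mul_mul_eq]
  exact frickeGL_mul_mul_inv_mem N hx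

/-- `w_N diag(1, n) = diag(n, 1) w_N` (Diamond–Shurman Ex. 5.5.1(b):
`diag(p, 1) = w_N⁻¹ diag(1, p) w_N` up to the central `w_N²`). [folklore] -/
lemma frickeGL_mul_diagGL (n : ℕ) [NeZero n] :
    glCast (frickeGL N : GL (Fin 2) ℚ) *
        glCast (diagGL 1 n one_pos (Nat.cast_pos.mpr (NeZero.pos n)) : GL (Fin 2) ℚ) =
      glCast (diagGL n 1 (Nat.cast_pos.mpr (NeZero.pos n)) one_pos : GL (Fin 2) ℚ) *
        glCast (frickeGL N : GL (Fin 2) ℚ) := by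
  refine Units.ext ?_
  rw [Matrix.GeneralLinearGroup.coe_mul, Matrix.GeneralLinearGroup.coe_mul, val_glCast_frickeGL]
  ext i j
  fin_cases i <;> fin_cases j <;> simp [diagGL, glCast, Matrix.mul_apply, Fin.sum_univ_two]

/-- `w_N⁻¹ diag(1, n) w_N = diag(n, 1)`. [folklore] -/
lemma frickeGL_inv_mul_diagGL_mul (n : ℕ) [NeZero n] :
    (glCast (frickeGL N : GL (Fin 2) ℚ))⁻¹ *
        glCast (diagGL 1 n one_pos (Nat.cast_pos.mpr (NeZero.pos n)) : GL (Fin 2) ℚ) *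
        glCast (frickeGL N : GL (Fin 2) ℚ) =
      glCast (diagGL n 1 (Nat.cast_pos.mpr (NeZero.pos n)) one_pos : GL (Fin 2) ℚ) := by
  rw [frickeGL_inv_mul_mul_eq, frickeGL_mul_diagGL, mul_inv_cancel_right]

omit [NeZero N] in
/-- **`diag(n, 1) ∈ Γ₀(N) diag(1, n) Γ₀(N)` for `gcd(n, N) = 1`**: both integer matrices have
determinant `n`, coprime entries and upper-left entry a unit mod `N`, so the row-and-column
reduction `exists_gamma1_mul_mul_gamma0_eq_diagonal` (Shimura 1971, Prop. 3.32) brings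
`diag(n, 1)` to `diag(1, n)` by `Γ₁(N)` on the left and `Γ₀(N)` on the right.
[cite: Shimura1971, Prop. 3.32(1)] -/
lemma diagGL_swap_mem_doubleCoset (n : ℕ) [NeZero n] (hn : n.Coprime N) :
    glCast (diagGL n 1 (Nat.cast_pos.mpr (NeZero.pos n)) one_pos : GL (Fin 2) ℚ) ∈
      DoubleCoset.doubleCoset
        (glCast (diagGL 1 n one_pos (Nat.cast_pos.mpr (NeZero.pos n)) : GL (Fin 2) ℚ))
        ((Gamma0 N : Subgroup (GL (Fin 2) ℝ)) : Set (GL (Fin 2) ℝ))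
        (Gamma0 N : Subgroup (GL (Fin 2) ℝ)) := by
  have hdet : Matrix.det !![(n : ℤ), 0; 0, 1] ≠ 0 := by
    simp [Matrix.det_fin_two_of, NeZero.ne n]
  have hcop : IsCoprime ((!![(n : ℤ), 0; 0, 1]) 0 0) (N : ℤ) := by
    simpa using Nat.isCoprime_iff_coprime.mpr hn
  obtain ⟨γ, δ, e, d, hγ, hδ, he0, hXeq, hediv, -, -⟩ :=
    HeckeTComm.exists_gamma1_mul_mul_gamma0_eq_diagonal N !![(n : ℤ), 0; 0, 1] hdet (by simp) hcop
  have he1 : e = 1 := by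
    have h := hediv 1 1
    simp only [Matrix.of_apply, Matrix.cons_val', Matrix.cons_val_one, Matrix.cons_val_fin_one] at h
    exact Int.eq_one_of_dvd_one he0.le h
  have hd : d = n := by
    have h := congrArg Matrix.det hXeq
    rw [Matrix.det_mul, Matrix.det_mul, Matrix.SpecialLinearGroup.det_coe,
      Matrix.SpecialLinearGroup.det_coe, one_mul, mul_one, he1] at h
    simp [Matrix.det_fin_two_of] at h
    linarith
  subst hd
  rw [he1] at hXeq
  -- in `GL(2, ℝ)`: `mapGL γ * diag(n,1) * mapGL δ = diag(1,n)`
  have hGL : mapGL ℝ γ * glCast (diagGL n 1 (Nat.cast_pos.mpr (NeZero.pos n)) one_pos :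
      GL (Fin 2) ℚ) * mapGL ℝ δ =
      glCast (diagGL 1 n one_pos (Nat.cast_pos.mpr (NeZero.pos n)) : GL (Fin 2) ℚ) := by
    refine Units.ext ?_
    have h := congrArg (fun M : Matrix (Fin 2) (Fin 2) ℤ ↦ M.map (Int.castRingHom ℝ)) hXeq
    simp only [Matrix.map_mul] at h
    have hD' : ((glCast (diagGL n 1 (Nat.cast_pos.mpr (NeZero.pos n)) one_pos : GL (Fin 2) ℚ) :
        GL (Fin 2) ℝ) : Matrix (Fin 2) (Fin 2) ℝ) = (!![(n : ℤ), 0; 0, 1]).map (Int.castRingHom ℝ) := by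
      ext i j
      fin_cases i <;> fin_cases j <;> simp [diagGL, glCast]
    have hD : ((glCast (diagGL 1 n one_pos (Nat.cast_pos.mpr (NeZero.pos n)) : GL (Fin 2) ℚ) :
        GL (Fin 2) ℝ) : Matrix (Fin 2) (Fin 2) ℝ) = (!![1, 0; 0, (n : ℤ)]).map (Int.castRingHom ℝ) := by
      ext i j
      fin_cases i <;> fin_cases j <;> simp [diagGL, glCast]
    rw [Matrix.GeneralLinearGroup.coe_mul, Matrix.GeneralLinearGroup.coe_mul, mapGL_coe_matrix,
      mapGL_coe_matrix, algebraMap_int_eq, hD', hD]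
    exact h
  refine DoubleCoset.mem_doubleCoset.mpr ⟨(mapGL ℝ γ)⁻¹, inv_mem ⟨γ, Gamma1_in_Gamma0 N hγ, rfl⟩,
    (mapGL ℝ δ)⁻¹, inv_mem ⟨δ, hδ, rfl⟩, ?_⟩
  rw [← hGL]
  group

/-- **Transport of a right coset decomposition under a normalising element.** If
`Γ g Γ = ⊔ᵢ Γ αᵢ`, `u` normalises `Γ` (in both directions) and `u^{±1} g u^{∓1} ∈ Γ g Γ`, then
also `Γ g Γ = ⊔ᵢ Γ (u⁻¹ αᵢ u)` (Diamond–Shurman Ex. 5.5.1(b), the coset representatives of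
`Γ₁(N) diag(p, 1) Γ₁(N)` obtained from those of `T_p` by conjugation with `w_N`). [folklore] -/
theorem IsDoubleCosetDecomp.conj {G : Type*} [Group G] {Γ : Subgroup G} {g u : G} {ι : Type*}
    {α : ι → G} (h : IsDoubleCosetDecomp Γ Γ g α)
    (hu : ∀ γ ∈ Γ, u * γ * u⁻¹ ∈ Γ) (hu' : ∀ γ ∈ Γ, u⁻¹ * γ * u ∈ Γ)
    (hg : u⁻¹ * g * u ∈ DoubleCoset.doubleCoset g (Γ : Set G) Γ)
    (hg' : u * g * u⁻¹ ∈ DoubleCoset.doubleCoset g (Γ : Set G) Γ) :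
    IsDoubleCosetDecomp Γ Γ g (fun i ↦ u⁻¹ * α i * u) where
  mem i := by
    obtain ⟨γ, hγ, γ', hγ', hi⟩ := DoubleCoset.mem_doubleCoset.mp (h.mem i)
    rw [hi, show u⁻¹ * (γ * g * γ') * u = (u⁻¹ * γ * u) * (u⁻¹ * g * u) * (u⁻¹ * γ' * u) by group]
    exact IsDoubleCosetDecomp.mul_mem_doubleCoset
      (IsDoubleCosetDecomp.mem_doubleCoset_mul (hu' γ hγ) hg) (hu' γ' hγ')
  existsUnique x hx := by
    have hy : u * x * u⁻¹ ∈ DoubleCoset.doubleCoset g (Γ : Set G) Γ := by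
      obtain ⟨γ, hγ, γ', hγ', rfl⟩ := DoubleCoset.mem_doubleCoset.mp hx
      rw [show u * (γ * g * γ') * u⁻¹ = (u * γ * u⁻¹) * (u * g * u⁻¹) * (u * γ' * u⁻¹) by group]
      exact IsDoubleCosetDecomp.mul_mem_doubleCoset
        (IsDoubleCosetDecomp.mem_doubleCoset_mul (hu γ hγ) hg') (hu γ' hγ')
    obtain ⟨i, hi, huniq⟩ := h.existsUnique _ hy
    have key : ∀ j, x * (u⁻¹ * α j * u)⁻¹ ∈ Γ ↔ u * x * u⁻¹ * (α j)⁻¹ ∈ Γ := fun j ↦ by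
      constructor
      · intro hj
        have h' := hu _ hj
        rwa [show u * (x * (u⁻¹ * α j * u)⁻¹) * u⁻¹ = u * x * u⁻¹ * (α j)⁻¹ by group] at h'
      · intro hj
        have h' := hu' _ hj
        rwa [show u⁻¹ * (u * x * u⁻¹ * (α j)⁻¹) * u = x * (u⁻¹ * α j * u)⁻¹ by group] at h'
    exact ⟨i, (key i).mpr hi, fun j hj ↦ huniq j ((key j).mp hj)⟩

open scoped ConjAct Pointwise in
/-- **`w_N` commutes with `T_n` for `gcd(n, N) = 1`** on `S_k(Γ₀(N))` (Atkin–Lehner 1970, Lemma 11;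
Diamond–Shurman Ex. 5.5.1(b) with Thm. 5.5.3: `w_N T_n w_N⁻¹ = T_n^* = T_n` on `Γ₀(N)` for
`(n, N) = 1`). Proof by double cosets: if `Γ₀(N) diag(1,n) Γ₀(N) = ⊔ᵢ Γ₀(N) αᵢ`, then also
`= ⊔ᵢ Γ₀(N) (w_N⁻¹ αᵢ w_N)` (`IsDoubleCosetDecomp.conj`, using `w_N⁻¹ diag(1,n) w_N = diag(n,1) ∈
Γ₀(N) diag(1,n) Γ₀(N)`, `diagGL_swap_mem_doubleCoset`), so
`T_n (w_N f) = c ∑ᵢ (f ∣ w_N) ∣ (w_N⁻¹ αᵢ w_N) = c ∑ᵢ f ∣ (αᵢ w_N) = w_N (T_n f)`.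
[cite: DiamondShurman2005, Ex. 5.5.1(b) and Thm. 5.5.3] -/
theorem frickeInvolution_heckeT (k : ℤ) (n : ℕ) [NeZero n] (hn : n.Coprime N)
    (f : CuspForm (Gamma0 N) k) :
    frickeInvolution N k (heckeT (Gamma0 N) k n f) =
      heckeT (Gamma0 N) k n (frickeInvolution N k f) := by
  set w := glCast (frickeGL N : GL (Fin 2) ℚ) with hw
  set D : GL (Fin 2) ℚ := (diagGL 1 n one_pos (Nat.cast_pos.mpr (NeZero.pos n)) : GL (Fin 2) ℚ)
    with hD
  letI := Fintype.ofFinite ((Gamma0 N : Subgroup (GL (Fin 2) ℝ)) ⧸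
    (ConjAct.toConjAct (glCast D)⁻¹ • (Gamma0 N : Subgroup (GL (Fin 2) ℝ))).subgroupOf (Gamma0 N))
  obtain ⟨m, α, hα⟩ := exists_isDoubleCosetDecomp (Gamma0 N : Subgroup (GL (Fin 2) ℝ))
    (Gamma0 N) (glCast D)
  have hβ : IsDoubleCosetDecomp (Gamma0 N : Subgroup (GL (Fin 2) ℝ)) (Gamma0 N) (glCast D)
      (fun i ↦ w⁻¹ * α i * w) :=
    hα.conj (fun γ hγ ↦ frickeGL_mul_mul_inv_mem N hγ) (fun γ hγ ↦ frickeGL_inv_mul_mul_mem N hγ)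
      (by rw [hw, hD, frickeGL_inv_mul_diagGL_mul]; exact diagGL_swap_mem_doubleCoset N n hn)
      (by rw [hw, hD, ← frickeGL_inv_mul_mul_eq, frickeGL_inv_mul_diagGL_mul]
          exact diagGL_swap_mem_doubleCoset N n hn)
  apply DFunLike.coe_injective
  have hfr := frickeInvolution_apply_eq_slash_holds N k
  have h1 : (⇑(heckeT (Gamma0 N) k n f) : ℍ → ℂ) = ∑ i, ⇑f ∣[k] α i :=
    coe_cuspHeckeCorrespondence_eq_sum _ _ k D hα f
  have h2 : (⇑(heckeT (Gamma0 N) k n (frickeInvolution N k f)) : ℍ → ℂ) =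
      ∑ i, ⇑(frickeInvolution N k f) ∣[k] (w⁻¹ * α i * w) :=
    coe_cuspHeckeCorrespondence_eq_sum _ _ k D hβ _
  rw [hfr (heckeT _ k n f), h1, h2, hfr f]
  rw [SlashAction.sum_slash, Finset.smul_sum]
  refine Finset.sum_congr rfl fun i _ ↦ ?_
  rw [ModularForm.smul_slash, σ_ofReal, ← SlashAction.slash_mul, ← SlashAction.slash_mul, ← hw,
    show w * (w⁻¹ * α i * w) = α i * w by group]

end FrickeHecke

/-! ### `w_N` preserves the new subspace -/

section FrickeNew

/-- **Left translation of a decomposition by a normalising element**: if `Γ g Γ' = ⊔ᵢ Γ αᵢ` and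
`u` normalises `Γ`, then `Γ (u g) Γ' = ⊔ᵢ Γ (u αᵢ)`. [folklore] -/
theorem IsDoubleCosetDecomp.normaliser_mul {G : Type*} [Group G] {Γ Γ' : Subgroup G} {g u : G}
    {ι : Type*} {α : ι → G} (h : IsDoubleCosetDecomp Γ Γ' g α)
    (hu : ∀ γ ∈ Γ, u * γ * u⁻¹ ∈ Γ) (hu' : ∀ γ ∈ Γ, u⁻¹ * γ * u ∈ Γ) :
    IsDoubleCosetDecomp Γ Γ' (u * g) (fun i ↦ u * α i) where
  mem i := by
    obtain ⟨γ, hγ, γ', hγ', hi⟩ := DoubleCoset.mem_doubleCoset.mp (h.mem i)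
    rw [hi, show u * (γ * g * γ') = (u * γ * u⁻¹) * (u * g) * γ' by group]
    exact DoubleCoset.mem_doubleCoset.mpr ⟨_, hu γ hγ, γ', hγ', rfl⟩
  existsUnique x hx := by
    have hy : u⁻¹ * x ∈ DoubleCoset.doubleCoset g (Γ : Set G) Γ' := by
      obtain ⟨γ, hγ, γ', hγ', rfl⟩ := DoubleCoset.mem_doubleCoset.mp hx
      rw [show u⁻¹ * (γ * (u * g) * γ') = (u⁻¹ * γ * u) * g * γ' by group]
      exact DoubleCoset.mem_doubleCoset.mpr ⟨_, hu' γ hγ, γ', hγ', rfl⟩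
    obtain ⟨i, hi, huniq⟩ := h.existsUnique _ hy
    have key : ∀ j, x * (u * α j)⁻¹ ∈ Γ ↔ u⁻¹ * x * (α j)⁻¹ ∈ Γ := fun j ↦ by
      constructor
      · intro hj
        have h' := hu' _ hj
        rwa [show u⁻¹ * (x * (u * α j)⁻¹) * u = u⁻¹ * x * (α j)⁻¹ by group] at h'
      · intro hj
        have h' := hu _ hj
        rwa [show u * (u⁻¹ * x * (α j)⁻¹) * u⁻¹ = x * (u * α j)⁻¹ by group] at h'
    exact ⟨i, (key i).mpr hi, fun j hj ↦ huniq j ((key j).mp hj)⟩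

/-- **Two-sided translation of a decomposition**: if `Γ g Γ' = ⊔ⱼ Γ βⱼ`, `z` is central and `v`
normalises `Γ'`, then `Γ (z g v) Γ' = ⊔ⱼ Γ (z βⱼ v)`. [folklore] -/
theorem IsDoubleCosetDecomp.centre_mul_mul_normaliser {G : Type*} [Group G] {Γ Γ' : Subgroup G}
    {g z v : G} {ι : Type*} {β : ι → G} (h : IsDoubleCosetDecomp Γ Γ' g β)
    (hz : ∀ x : G, z * x = x * z)
    (hv : ∀ γ ∈ Γ', v * γ * v⁻¹ ∈ Γ') (hv' : ∀ γ ∈ Γ', v⁻¹ * γ * v ∈ Γ') :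
    IsDoubleCosetDecomp Γ Γ' (z * g * v) (fun j ↦ z * β j * v) where
  mem j := by
    obtain ⟨γ, hγ, γ', hγ', hj⟩ := DoubleCoset.mem_doubleCoset.mp (h.mem j)
    rw [hj, show z * (γ * g * γ') * v = (z * γ) * g * (v * (v⁻¹ * γ' * v) * v⁻¹) * v by group, hz γ,
      show γ * z * g * (v * (v⁻¹ * γ' * v) * v⁻¹) * v = γ * (z * g * v) * (v⁻¹ * γ' * v) by group]
    exact DoubleCoset.mem_doubleCoset.mpr ⟨γ, hγ, _, hv' γ' hγ', rfl⟩
  existsUnique x hx := by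
    have hzi : ∀ y : G, z⁻¹ * y = y * z⁻¹ := fun y ↦ ((show Commute z y from hz y).inv_left).eq
    have hy : z⁻¹ * x * v⁻¹ ∈ DoubleCoset.doubleCoset g (Γ : Set G) Γ' := by
      obtain ⟨γ, hγ, γ', hγ', rfl⟩ := DoubleCoset.mem_doubleCoset.mp hx
      rw [show z⁻¹ * (γ * (z * g * v) * γ') * v⁻¹ = (z⁻¹ * γ) * z * g * (v * γ' * v⁻¹) by group,
        hzi γ, show γ * z⁻¹ * z * g * (v * γ' * v⁻¹) = γ * g * (v * γ' * v⁻¹) by group]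
      exact DoubleCoset.mem_doubleCoset.mpr ⟨γ, hγ, _, hv γ' hγ', rfl⟩
    obtain ⟨i, hi, huniq⟩ := h.existsUnique _ hy
    have key : ∀ j, x * (z * β j * v)⁻¹ = z⁻¹ * x * v⁻¹ * (β j)⁻¹ := fun j ↦ by
      rw [mul_inv_rev, mul_inv_rev, show z⁻¹ * x * v⁻¹ * (β j)⁻¹ = z⁻¹ * (x * v⁻¹ * (β j)⁻¹) by group,
        hzi]
      group
    refine ⟨i, ?_, fun j hj ↦ huniq j ?_⟩
    · show x * (z * β i * v)⁻¹ ∈ Γ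
      rw [key]
      exact hi
    · have hj' : x * (z * β j * v)⁻¹ ∈ Γ := hj
      show z⁻¹ * x * v⁻¹ * (β j)⁻¹ ∈ Γ
      rw [← key]
      exact hj'

variable (N : ℕ) [NeZero N]

/-- `w_N diag(1, d) = (d · 1) diag(1, d') w_M` when `M d d' = N`: the matrix identity behind
"`W_N` maps `d`-old forms from level `M` to `d'`-old forms" (Atkin–Lehner 1970, Lemma 26).
[folklore] -/
lemma frickeGL_mul_diagGL_one_eq {M d d' : ℕ} [NeZero M] [NeZero d] [NeZero d']
    (h : M * d * d' = N) :
    glCast (frickeGL N : GL (Fin 2) ℚ) *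
        glCast (diagGL 1 d one_pos (Nat.cast_pos.mpr (NeZero.pos d)) : GL (Fin 2) ℚ) =
      glCast (diagGL d d (Nat.cast_pos.mpr (NeZero.pos d)) (Nat.cast_pos.mpr (NeZero.pos d)) :
          GL (Fin 2) ℚ) *
        glCast (diagGL 1 d' one_pos (Nat.cast_pos.mpr (NeZero.pos d')) : GL (Fin 2) ℚ) *
        glCast (frickeGL M : GL (Fin 2) ℚ) := by
  have hN : (N : ℝ) = M * d * d' := by exact_mod_cast h.symm
  refine Units.ext ?_
  rw [Matrix.GeneralLinearGroup.coe_mul, Matrix.GeneralLinearGroup.coe_mul,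
    Matrix.GeneralLinearGroup.coe_mul, val_glCast_frickeGL, val_glCast_frickeGL]
  ext i j
  fin_cases i <;> fin_cases j <;>
    (simp [diagGL, glCast, Matrix.mul_apply, Fin.sum_univ_two, hN]; try ring)

/-- Scalar matrices `d · 1` are central in `GL(2, ℝ)`. [folklore] -/
lemma diagGL_self_mul_comm (d : ℕ) [NeZero d] (x : GL (Fin 2) ℝ) :
    glCast (diagGL d d (Nat.cast_pos.mpr (NeZero.pos d)) (Nat.cast_pos.mpr (NeZero.pos d)) :
        GL (Fin 2) ℚ) * x =
      x * glCast (diagGL d d (Nat.cast_pos.mpr (NeZero.pos d)) (Nat.cast_pos.mpr (NeZero.pos d)) :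
        GL (Fin 2) ℚ) := by
  refine Units.ext ?_
  rw [Matrix.GeneralLinearGroup.coe_mul, Matrix.GeneralLinearGroup.coe_mul]
  ext i j
  fin_cases i <;> fin_cases j <;> simp [diagGL, glCast, Matrix.mul_apply, Fin.sum_univ_two] <;> ring

/-- Slashing by the scalar matrix `d · 1` multiplies a weight-`k` function by `d^{k-2}` (Mathlib's
`|det|^{k-1}`-normalised slash action). [folklore] -/
lemma slash_diagGL_self (f : ℍ → ℂ) (k : ℤ) (d : ℕ) [NeZero d] :
    f ∣[k] glCast (diagGL d d (Nat.cast_pos.mpr (NeZero.pos d)) (Nat.cast_pos.mpr (NeZero.pos d)) :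
        GL (Fin 2) ℚ) = (((d : ℝ) ^ (k - 2) : ℝ) : ℂ) • f := by
  have hd0 : (d : ℂ) ≠ 0 := by exact_mod_cast NeZero.ne d
  rw [show (((d : ℝ) ^ (k - 2) : ℝ) : ℂ) = (d : ℂ) ^ (k - 2) by push_cast; rfl]
  have hdet : (glCast (diagGL d d (Nat.cast_pos.mpr (NeZero.pos d))
      (Nat.cast_pos.mpr (NeZero.pos d)) : GL (Fin 2) ℚ)).det.val = d * d := by
    rw [Matrix.GeneralLinearGroup.val_det_apply]
    simp [diagGL, glCast, Matrix.det_fin_two]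
  have hval : ((glCast (diagGL d d (Nat.cast_pos.mpr (NeZero.pos d))
      (Nat.cast_pos.mpr (NeZero.pos d)) : GL (Fin 2) ℚ) : GL (Fin 2) ℝ) : Matrix (Fin 2) (Fin 2) ℝ) =
      !![(d : ℝ), 0; 0, d] := by
    ext i j
    fin_cases i <;> fin_cases j <;> simp [diagGL, glCast]
  ext τ
  have hpt : (glCast (diagGL d d (Nat.cast_pos.mpr (NeZero.pos d))
      (Nat.cast_pos.mpr (NeZero.pos d)) : GL (Fin 2) ℚ) • τ : ℍ) = τ := by
    refine UpperHalfPlane.ext ?_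
    rw [coe_smul_of_det_pos (by rw [hdet]; exact_mod_cast mul_pos (NeZero.pos d) (NeZero.pos d)),
      num, denom, hval]
    simp only [Matrix.of_apply, Matrix.cons_val', Matrix.cons_val_zero, Matrix.cons_val_one,
      Matrix.cons_val_fin_one]
    push_cast
    rw [add_zero, zero_mul, zero_add]
    exact mul_div_cancel_left₀ _ hd0
  rw [ModularForm.slash_apply, σ_glCast, hpt, hdet, denom, hval, Pi.smul_apply, smul_eq_mul]
  simp only [Matrix.of_apply, Matrix.cons_val', Matrix.cons_val_zero, Matrix.cons_val_one,
    Matrix.cons_val_fin_one]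
  push_cast
  rw [abs_of_nonneg (by positivity : (0 : ℝ) ≤ d * d)]
  push_cast
  rw [zero_mul, zero_add, show (d : ℂ) * d = (d : ℂ) ^ (2 : ℤ) by rw [zpow_two], ← zpow_mul,
    zpow_neg, show (2 : ℤ) * (k - 1) = k + (k - 2) by ring, zpow_add₀ hd0]
  field_simp

open scoped ConjAct Pointwise in
/-- **The Fricke involution preserves the new subspace** `S_k(Γ₀(N))^{new} = ⋂ ker` (adjoint
degeneracy maps) (Atkin–Lehner 1970, Lemma 26). For an index
`(M, d)`, `M d d' = N`: the adjoint degeneracy map `[Γ₀(N) diag(1,d) Γ₀(M)]` applied to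
`w_N f = c (f ∣ w_N)` is `c ∑ᵢ f ∣ (w_N αᵢ)`, a sum over representatives of
`Γ₀(N) \ Γ₀(N) (w_N diag(1,d)) Γ₀(M)` (`IsDoubleCosetDecomp.normaliser_mul`); since
`w_N diag(1,d) = (d·1) diag(1,d') w_M` (`frickeGL_mul_diagGL_one_eq`), another system of
representatives is `{(d·1) βⱼ w_M}` for `Γ₀(N) diag(1,d') Γ₀(M) = ⊔ⱼ Γ₀(N) βⱼ`
(`IsDoubleCosetDecomp.centre_mul_mul_normaliser`), and the sum becomes
`c d^{k-2} (∑ⱼ f ∣ βⱼ) ∣ w_M = c d^{k-2} (adj_{d'} f) ∣ w_M = 0` for `f` new.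
[cite: AtkinLehner1970, Lemma 26] -/
theorem frickeInvolution_mem_newSubspace0 (k : ℤ) {f : CuspForm (Gamma0 N) k}
    (hf : f ∈ newSubspace0 N k) : frickeInvolution N k f ∈ newSubspace0 N k := by
  rw [newSubspace0, Submodule.mem_iInf] at hf ⊢
  intro Md
  obtain ⟨⟨M, d⟩, hM, hMd⟩ := Md
  rw [LinearMap.mem_ker]
  dsimp only
  -- the complementary index `(M, d')`, `M d d' = N`
  obtain ⟨d', hd'⟩ := hMd
  haveI hM0 : NeZero M := ⟨(Nat.pos_of_mem_properDivisors hM).ne'⟩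
  haveI hd0 : NeZero d := ⟨fun h ↦ NeZero.ne N (by simp [hd', h])⟩
  haveI hd'0 : NeZero d' := ⟨fun h ↦ NeZero.ne N (by simp [hd', h])⟩
  have hMdd' : M * d * d' = N := hd'.symm
  have hf' : adjDegeneracyMap0 N M d' k f = 0 := by
    have := hf ⟨(M, d'), hM, ⟨d, by rw [hd']; ring⟩⟩
    rwa [LinearMap.mem_ker] at this
  -- notation
  set wN := glCast (frickeGL N : GL (Fin 2) ℚ) with hwN
  set wM := glCast (frickeGL M : GL (Fin 2) ℚ) with hwM
  set Dd : GL (Fin 2) ℚ := (diagGL 1 d one_pos (Nat.cast_pos.mpr (NeZero.pos d)) : GL (Fin 2) ℚ)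
    with hDd
  set Dd' : GL (Fin 2) ℚ := (diagGL 1 d' one_pos (Nat.cast_pos.mpr (NeZero.pos d')) : GL (Fin 2) ℚ)
    with hDd'
  set Sd := glCast (diagGL d d (Nat.cast_pos.mpr (NeZero.pos d)) (Nat.cast_pos.mpr (NeZero.pos d)) :
    GL (Fin 2) ℚ) with hSd
  -- decompositions
  letI := Fintype.ofFinite ((Gamma0 M : Subgroup (GL (Fin 2) ℝ)) ⧸
    (ConjAct.toConjAct (glCast Dd)⁻¹ • (Gamma0 N : Subgroup (GL (Fin 2) ℝ))).subgroupOf (Gamma0 M))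
  letI := Fintype.ofFinite ((Gamma0 M : Subgroup (GL (Fin 2) ℝ)) ⧸
    (ConjAct.toConjAct (glCast Dd')⁻¹ • (Gamma0 N : Subgroup (GL (Fin 2) ℝ))).subgroupOf (Gamma0 M))
  obtain ⟨m, α, hα⟩ := exists_isDoubleCosetDecomp (Gamma0 N : Subgroup (GL (Fin 2) ℝ))
    (Gamma0 M) (glCast Dd)
  obtain ⟨m', β, hβ⟩ := exists_isDoubleCosetDecomp (Gamma0 N : Subgroup (GL (Fin 2) ℝ))
    (Gamma0 M) (glCast Dd')
  have hmul : ∀ a b : GL (Fin 2) ℚ, glCast (a * b) = glCast a * glCast b := fun a b ↦ map_mul _ a b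
  have hA : IsDoubleCosetDecomp (Gamma0 N : Subgroup (GL (Fin 2) ℝ)) (Gamma0 M)
      (glCast ((frickeGL N : GL (Fin 2) ℚ) * Dd)) (fun i ↦ wN * α i) := by
    rw [hmul]
    exact hα.normaliser_mul (fun γ hγ ↦ frickeGL_mul_mul_inv_mem N hγ)
      (fun γ hγ ↦ frickeGL_inv_mul_mul_mem N hγ)
  have hB : IsDoubleCosetDecomp (Gamma0 N : Subgroup (GL (Fin 2) ℝ)) (Gamma0 M)
      (glCast ((frickeGL N : GL (Fin 2) ℚ) * Dd)) (fun j ↦ Sd * β j * wM) := by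
    rw [hmul, show glCast (frickeGL N : GL (Fin 2) ℚ) * glCast Dd = Sd * glCast Dd' * wM from
      frickeGL_mul_diagGL_one_eq N hMdd']
    exact hβ.centre_mul_mul_normaliser (diagGL_self_mul_comm d)
      (fun γ hγ ↦ frickeGL_mul_mul_inv_mem M hγ) (fun γ hγ ↦ frickeGL_inv_mul_mul_mem M hγ)
  -- the computation, on underlying functions
  apply DFunLike.coe_injective
  have hfr := frickeInvolution_apply_eq_slash_holds N k
  have e1 : (⇑(adjDegeneracyMap0 N M d k (frickeInvolution N k f)) : ℍ → ℂ) =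
      ∑ i, ⇑(frickeInvolution N k f) ∣[k] α i :=
    coe_cuspHeckeCorrespondence_eq_sum _ _ k Dd hα _
  have e2 : (⇑(cuspHeckeCorrespondence (Gamma0 N) (Gamma0 M) k ((frickeGL N : GL (Fin 2) ℚ) * Dd) f) :
      ℍ → ℂ) = ∑ i, ⇑f ∣[k] (wN * α i) :=
    coe_cuspHeckeCorrespondence_eq_sum _ _ k _ hA f
  have e3 : (⇑(cuspHeckeCorrespondence (Gamma0 N) (Gamma0 M) k ((frickeGL N : GL (Fin 2) ℚ) * Dd) f) :
      ℍ → ℂ) = ∑ j, ⇑f ∣[k] (Sd * β j * wM) :=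
    coe_cuspHeckeCorrespondence_eq_sum _ _ k _ hB f
  have e4 : (⇑(adjDegeneracyMap0 N M d' k f) : ℍ → ℂ) = ∑ j, ⇑f ∣[k] β j :=
    coe_cuspHeckeCorrespondence_eq_sum _ _ k Dd' hβ f
  rw [hf'] at e4
  rw [e1, hfr f, CuspForm.coe_zero]
  simp_rw [ModularForm.smul_slash, σ_ofReal, ← SlashAction.slash_mul]
  rw [← Finset.smul_sum, ← hwN, ← e2, e3]
  simp_rw [SlashAction.slash_mul, hSd, slash_diagGL_self, ModularForm.smul_slash, σ_ofReal]
  rw [← Finset.smul_sum, ← SlashAction.sum_slash, ← e4, CuspForm.coe_zero, SlashAction.zero_slash,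
    smul_zero, smul_zero]

end FrickeNew

/-! ### Atkin–Lehner, Thm. 3 (the `w_N` part) from multiplicity one -/

section AtkinLehner

/-- **Simultaneous eigenvectors in the span of a linearly independent eigenfamily.** If `v` is a
linearly independent family of `T`-eigenvectors, `T vᵢ = μᵢ vᵢ`, and `x = ∑ lᵢ vᵢ` satisfies
`T x = a x`, then `μᵢ = a` whenever `lᵢ ≠ 0` (compare coefficients of `(T - a) x = 0`).
[folklore] -/
theorem eq_of_linearCombination_eigenvector {ι V : Type*} [AddCommGroup V] [Module ℂ V]
    {v : ι → V} (hv : LinearIndependent ℂ v) (T : V →ₗ[ℂ] V) (μ : ι → ℂ)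
    (hT : ∀ i, T (v i) = μ i • v i) (l : ι →₀ ℂ) (a : ℂ)
    (hx : T (Finsupp.linearCombination ℂ v l) = a • Finsupp.linearCombination ℂ v l) :
    ∀ i, l i ≠ 0 → μ i = a := by
  classical
  let l' : ι →₀ ℂ := Finsupp.onFinset l.support (fun i ↦ l i * (μ i - a)) (fun i hi ↦ by
    rw [Finsupp.mem_support_iff]
    exact fun h0 ↦ hi (by rw [h0, zero_mul]))
  have hsub : l'.support ⊆ l.support := Finsupp.support_onFinset_subset
  have h0 : Finsupp.linearCombination ℂ v l' = 0 := by
    have h1 : Finsupp.linearCombination ℂ v l' = ∑ i ∈ l.support, (l i * (μ i - a)) • v i := by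
      rw [Finsupp.linearCombination_apply, Finsupp.sum_of_support_subset l' hsub _ (by simp)]
      refine Finset.sum_congr rfl fun i _ ↦ ?_
      rw [Finsupp.onFinset_apply]
    have h2 : T (Finsupp.linearCombination ℂ v l) - a • Finsupp.linearCombination ℂ v l =
        ∑ i ∈ l.support, (l i * (μ i - a)) • v i := by
      rw [Finsupp.linearCombination_apply, Finsupp.sum, map_sum, Finset.smul_sum,
        ← Finset.sum_sub_distrib]
      refine Finset.sum_congr rfl fun i _ ↦ ?_
      rw [map_smul, hT, smul_smul, smul_smul, ← sub_smul]
      congr 1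
      ring
    rw [h1, ← h2, hx, sub_self]
  have hl' : l' = 0 := linearIndependent_iff.mp hv l' h0
  intro i hi
  have h := DFunLike.congr_fun hl' i
  rw [Finsupp.onFinset_apply, Finsupp.zero_apply, mul_eq_zero, sub_eq_zero] at h
  exact h.resolve_left hi

variable (N : ℕ) [NeZero N] (k : ℤ)

/-- **Atkin–Lehner, Thm. 3, the `w_N` part, from multiplicity one.** Assume the structural named
facts on newforms of `Newforms.lean` — the newforms span the new subspace and are linearly
independent (`span_newforms0`, `linearIndependent_newforms0`: Atkin–Lehner 1970, Thm. 5;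
Diamond–Shurman Thm. 5.8.3) and strong multiplicity one at the same level
(`IsNewform0.eq_of_heckeEigenvalue_eq`: Atkin–Lehner 1970, Thm. 4). Then every newform
`f ∈ S_k(Γ₀(N))` is a `w_N`-eigenvector with eigenvalue `±1`
(`IsNewform0.exists_frickeInvolution_eq_smul`). Proof as in Atkin–Lehner / Diamond–Shurman
Thm. 5.8.2: `g = w_N f` is new (`frickeInvolution_mem_newSubspace0`) and `T_p g = a_p(f) g` for
`p ∤ N` (`frickeInvolution_heckeT`); writing `g = ∑ c_φ φ` over newforms, each `φ` with `c_φ ≠ 0`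
has `a_p(φ) = a_p(f)` for all `p ∤ N` (`eq_of_linearCombination_eigenvector`), hence `φ = f`; so
`g = ε f`, and `ε² f = w_N² f = (-1)^k f = f` (`frickeInvolution_frickeInvolution_holds`; `k` is
even as `f ≠ 0`, `eq_zero_of_odd_weight_gamma0`) gives `ε = ±1`.
[cite: AtkinLehner1970, Thm. 3] [cite: DiamondShurman2005, Thm. 5.8.2] -/
theorem IsNewform0.exists_frickeInvolution_eq_smul_of (hspan : span_newforms0 N k)
    (hli : linearIndependent_newforms0 N k)
    (hmult : IsNewform0.eq_of_heckeEigenvalue_eq (N := N) (k := k)) :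
    IsNewform0.exists_frickeInvolution_eq_smul (N := N) (k := k) := by
  intro f hf
  have hspan' : Submodule.span ℂ (newforms0 N k) = newSubspace0 N k := hspan
  have hli' : LinearIndependent ℂ (Subtype.val : newforms0 N k → CuspForm (Gamma0 N) k) := hli
  set g := frickeInvolution N k f with hg
  have hg_span : g ∈ Submodule.span ℂ (newforms0 N k) := by
    rw [hspan']
    exact frickeInvolution_mem_newSubspace0 N k hf.1
  obtain ⟨l, hl⟩ := (Finsupp.mem_span_iff_linearCombination ℂ (newforms0 N k) g).mp hg_span
  -- every newform in the support of `l` is `f`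
  have key : ∀ φ : newforms0 N k, l φ ≠ 0 → (φ : CuspForm (Gamma0 N) k) = f := by
    intro φ hφ
    refine hmult φ.2 hf ((Finset.finite_toSet N.primeFactors).subset ?_)
    rintro p ⟨hp, hne⟩
    by_contra hpN
    have hpN' : ¬p ∣ N := fun hdvd ↦ hpN (Nat.mem_primeFactors.mpr ⟨hp, hdvd, NeZero.ne N⟩)
    apply hne
    haveI : NeZero p := ⟨hp.ne_zero⟩
    have hTg : heckeT (Gamma0 N) k p g = heckeEigenvalue f p • g := by
      rw [hg, ← frickeInvolution_heckeT N k p ((Nat.Prime.coprime_iff_not_dvd hp).mpr hpN') f,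
        heckeT_eq_heckeEigenvalue_smul f p (hf.2.1 p hp), map_smul]
    rw [← hl] at hTg
    exact eq_of_linearCombination_eigenvector hli' (heckeT (Gamma0 N) k p)
      (fun φ ↦ heckeEigenvalue φ.1 p)
      (fun φ ↦ heckeT_eq_heckeEigenvalue_smul φ.1 p (φ.2.2.1 p hp)) l _ hTg φ hφ
  have hsupp : l.support ⊆ {⟨f, hf⟩} := fun φ hφ ↦
    Finset.mem_singleton.mpr (Subtype.ext (key φ (Finsupp.mem_support_iff.mp hφ)))
  set ε : ℂ := l ⟨f, hf⟩ with hε_def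
  have hg_eq : g = ε • f := by
    rw [← hl, Finsupp.linearCombination_apply, Finsupp.sum_of_support_subset l hsupp _ (by simp),
      Finset.sum_singleton]
  -- `ε² = 1`
  have hf0 : f ≠ 0 := fun h0 ↦ hf.coe_ne_zero (by rw [h0]; rfl)
  have hk : Even k := by
    by_contra hodd
    rw [Int.not_even_iff_odd] at hodd
    exact hf0 (eq_zero_of_odd_weight_gamma0 N hodd f)
  have hεε : ε * ε = 1 := by
    have h1 := frickeInvolution_frickeInvolution_holds N k f
    rw [← hg, hg_eq, map_smul, ← hg, hg_eq, smul_smul, hk.neg_one_zpow, one_smul] at h1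
    have h2 : (ε * ε - 1) • f = 0 := by rw [sub_smul, one_smul, h1, sub_self]
    exact sub_eq_zero.mp ((smul_eq_zero.mp h2).resolve_right hf0)
  have hε : ε = 1 ∨ ε = -1 := by
    have h3 : (ε - 1) * (ε + 1) = 0 := by linear_combination hεε
    rcases mul_eq_zero.mp h3 with h | h
    · exact Or.inl (by linear_combination h)
    · exact Or.inr (by linear_combination h)
  exact ⟨ε, hε, hg_eq⟩

/-- **All three Atkin–Lehner `w_N`-facts of `CuspFormLFunction.lean` and Hecke's functional
equation for newforms, from the structure theory of newforms.** Under `span_newforms0`,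
`linearIndependent_newforms0` and `IsNewform0.eq_of_heckeEigenvalue_eq` at level `N`, weight `k`:
`IsNewform0.exists_frickeInvolution_eq_smul`, `IsNewform0.frickeInvolution_eq_smul`,
`IsNewform0.frickeEigenvalue_eq_one_or_eq_neg_one` and `IsNewform0.exists_functional_equation`
all hold (Atkin–Lehner 1970, Thms. 3–5; Hecke 1936). [cite: AtkinLehner1970, Thm. 3] -/
theorem IsNewform0.frickeFacts_of_multiplicityOne (hspan : span_newforms0 N k)
    (hli : linearIndependent_newforms0 N k)
    (hmult : IsNewform0.eq_of_heckeEigenvalue_eq (N := N) (k := k)) :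
    IsNewform0.exists_frickeInvolution_eq_smul (N := N) (k := k) ∧
      IsNewform0.frickeInvolution_eq_smul (N := N) (k := k) ∧
      IsNewform0.frickeEigenvalue_eq_one_or_eq_neg_one (N := N) (k := k) ∧
      IsNewform0.exists_functional_equation (N := N) (k := k) :=
  by
  have h : IsNewform0.exists_frickeInvolution_eq_smul (N := N) (k := k) :=
    IsNewform0.exists_frickeInvolution_eq_smul_of N k hspan hli hmult
  have h' : IsNewform0.frickeInvolution_eq_smul (N := N) (k := k) :=
    IsNewform0.frickeInvolution_eq_smul_of h
  exact ⟨h, h', IsNewform0.frickeEigenvalue_eq_one_or_eq_neg_one_of h,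
    IsNewform0.exists_functional_equation_of_frickeInvolution_eq_smul (N := N) (k := k) h'⟩

end AtkinLehner

end Literature.NumberTheory.EllipticCurves.ModularForms
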